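import Summits.HodgeConjecture.HodgeConjecture.Theorems.Q8SymplecticPowersEndomorphismMatrix
import Summits.HodgeConjecture.HodgeConjecture.Theorems.Q8SymplecticPowersCommutatorAscent
import Literature.RepresentationTheory.ClassicalInvariants.SymplecticInvolutionTensorFFT
import HarnessLib

/-!
# Route `Q8SymplecticPowers`, programme K2Q — brick E-Q part 2b: **an endomorphism of a rational quadratic space with a
# quaternionic structure that commutes with every commutator of the quaternionic-unitary centraliser is a quaternion**

Support file for crux K2Q `PowersHodgeOfQuaternionCommutators` (stmt-HodgeConjecture-24191; `--supports … --as helper`;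
nothing here closes an item).  Prover seat `hodge-nonav-20241-p1` (g20).  Pure linear algebra; the END-BOUND
`dim_ℚ End_HS(T(X)) ≤ 4` of the square case `stub_squareQ` is this theorem fed by brick E-Q1 (`hom_apply_commutator_eq`).

**`exists_eq_quaternion_of_commute_commutators`.**  Let `W` be a finite-dimensional `ℚ`-space with a symmetric nondegenerate
form `Q`, and `a, b ∈ O(Q)` with `a² = b² = -1`, `ab = -ba` (so `D = ℚ⟨a, b⟩` is the Hamilton quaternion algebra).  If
`φ ∈ End(W)` commutes with `g h g⁻¹ h⁻¹` for all `g, h ∈ GL(W)` commuting with `a, b` and preserving `Q` — the `ℚ`-POINTS of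
the quaternionic-unitary centraliser — then `φ = α + βa + γb + δab` with `α, β, γ, δ ∈ ℚ`.

Proof (the K2Q END-BOUND chain): in coordinates `A, B, G, P`; the `(2,0)`-tensor `P G⁻¹` is invariant under `M ⊗ M` for
every commutator `M` of `ℚ`-points (E-Q2a `mul_mul_transpose_eq_of_commute`); by the Cayley ascent ASC-Q
(`commutator_invariance_ascends₂`, p709049) it is invariant under the commutators of all Cayley `ℂ`-points, i.e. `P ⊗ 1`
commutes with them (E-Q2a `commute_of_mul_mul_transpose_eq`); by ENGINE-CAYLEY in matrix form (E-Q2a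
`exists_eq_quaternion_of_commute_cayley_commutators`, from p708176) `P ⊗ 1 ∈ ℂ⟨1, A, B, AB⟩`; and a rational matrix in
the `ℂ`-span of rational matrices is in their `ℚ`-span (`exists_rat_coeffs_of_map_eq`, via a `ℚ`-linear retraction
`ℂ → ℚ` of `1`).  HONEST FRAMING: linear algebra only (axioms standard); item 24191 OPEN; nothing here says HC ∕ HC_CM ∕
HC_AV is proved.

## References

* R. Goodman, N. Wallach, *Symmetry, Representations, and Invariants*, GTM 255, §1.4.5 Exercise 5, §4.2, §5.3.2.
  [cite: GoodmanWallachGTM255]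
* O. T. O'Meara, *Introduction to Quadratic Forms* (1963), §41–§43. [cite: Omeara1963]
-/

set_option linter.dupNamespace false

noncomputable section

open Matrix
open scoped BigOperators

namespace Summit.HodgeConjecture.HodgeConjecture.Theorems.Q8SymplecticPowersEndomorphismAlgebra

open Literature.NumberTheory.DiophantineGeometry (tensorPowerMatrix tensorPowerMatrix_apply)
open Literature.RepresentationTheory.ClassicalInvariants (toMatrix_toLinearEquiv isometry_toLinearEquiv comm_toLinearEquiv)
open Summit.HodgeConjecture.HodgeConjecture.Theorems.Q8SymplecticPowersEndomorphismMatrix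
open Summit.HodgeConjecture.HodgeConjecture.Theorems.Q8SymplecticPowersCommutatorAscent

/-! ### §1 Descent of coefficients from `ℂ` to `ℚ` -/

/-- There is a `ℚ`-linear functional `λ : ℂ → ℚ` with `λ 1 = 1` (extend the coordinate of the line `ℚ · 1`). [folklore] -/
theorem exists_ratLinear_retraction : ∃ l : ℂ →ₗ[ℚ] ℚ, l 1 = 1 := by
  obtain ⟨g, hg⟩ := (LinearEquiv.coord ℚ ℂ (1 : ℂ) one_ne_zero).toLinearMap.exists_extend
  refine ⟨g, ?_⟩
  have h := LinearMap.congr_fun hg ⟨1, Submodule.mem_span_singleton_self (1 : ℂ)⟩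
  rw [LinearMap.comp_apply, Submodule.subtype_apply, LinearEquiv.coe_toLinearMap, LinearEquiv.coord_self] at h
  exact h

/-- **A rational matrix in the `ℂ`-span of `1, A, B, AB` (rational) lies in their `ℚ`-span.** [folklore] -/
theorem exists_rat_coeffs_of_map_eq {N : ℕ} (P A B : Matrix (Fin N) (Fin N) ℚ) {α β γ δ : ℂ}
    (h : P.map (algebraMap ℚ ℂ) = α • 1 + β • A.map (algebraMap ℚ ℂ) + γ • B.map (algebraMap ℚ ℂ) +
      δ • (A.map (algebraMap ℚ ℂ) * B.map (algebraMap ℚ ℂ))) :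
    ∃ α' β' γ' δ' : ℚ, P = α' • 1 + β' • A + γ' • B + δ' • (A * B) := by
  obtain ⟨l, hl⟩ := exists_ratLinear_retraction
  refine ⟨l α, l β, l γ, l δ, ?_⟩
  have h1 : (1 : Matrix (Fin N) (Fin N) ℂ) = (1 : Matrix (Fin N) (Fin N) ℚ).map (algebraMap ℚ ℂ) :=
    (Matrix.map_one (algebraMap ℚ ℂ) (map_zero _) (map_one _)).symm
  rw [h1, ← Matrix.map_mul] at h
  have hsm : ∀ (z : ℂ) (q : ℚ), z * algebraMap ℚ ℂ q = q • z := fun z q => by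
    rw [Algebra.smul_def, mul_comm]
  have hlq : ∀ q : ℚ, l (algebraMap ℚ ℂ q) = q := fun q => by
    rw [Algebra.algebraMap_eq_smul_one, map_smul, hl, smul_eq_mul, mul_one]
  ext i j
  have hij := congr_fun (congr_fun h i) j
  simp only [Matrix.map_apply, Matrix.add_apply, Matrix.smul_apply, smul_eq_mul] at hij
  have hl' := congr_arg l hij
  rw [hlq, hsm, hsm, hsm, hsm, map_add, map_add, map_add, map_smul, map_smul, map_smul, map_smul] at hl'
  rw [hl']
  simp only [Matrix.add_apply, Matrix.smul_apply, smul_eq_mul]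
  ring

/-! ### §2 Base change of the matrix data to `ℂ` -/

section MapLemmas

variable {N : ℕ}

/-- `(G⁻¹) ⊗ 1 = (G ⊗ 1)⁻¹` for an invertible rational matrix. [folklore] -/
theorem map_nonsing_inv (G : Matrix (Fin N) (Fin N) ℚ) (hG : IsUnit G.det) :
    (G⁻¹).map (algebraMap ℚ ℂ) = (G.map (algebraMap ℚ ℂ))⁻¹ := by
  refine (Matrix.inv_eq_left_inv ?_).symm
  rw [← Matrix.map_mul, Matrix.nonsing_inv_mul _ hG, Matrix.map_one _ (map_zero _) (map_one _)]

/-- `det (G ⊗ 1)` is a unit when `det G` is. [folklore] -/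
theorem isUnit_det_map (G : Matrix (Fin N) (Fin N) ℚ) (hG : IsUnit G.det) : IsUnit (G.map (algebraMap ℚ ℂ)).det := by
  have h := hG.map (algebraMap ℚ ℂ)
  rwa [RingHom.map_det] at h

end MapLemmas

/-! ### §3 The theorem -/

/-- **An endomorphism commuting with every commutator of the `ℚ`-points of the quaternionic-unitary centraliser is a
quaternion.**  For a finite-dimensional `ℚ`-space `W` with a symmetric nondegenerate form `Q`, `Q`-isometries `a, b` with
`a² = b² = -1`, `ab = -ba`, and `φ ∈ End(W)` with `φ [g, h] = [g, h] φ` for all `g, h ∈ GL(W)` commuting with `a`, `b` and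
preserving `Q`: `φ = α + βa + γb + δab` for some `α, β, γ, δ ∈ ℚ`.  (Cayley ascent ASC-Q to `ℂ`-points + ENGINE-CAYLEY +
descent.) [cite: GoodmanWallachGTM255, §1.4.5 Exercise 5, §4.2 and §5.3.2] -/
theorem exists_eq_quaternion_of_commute_commutators {W : Type*} [AddCommGroup W] [Module ℚ W] [Module.Finite ℚ W]
    (Q : LinearMap.BilinForm ℚ W) (hQs : ∀ x y, Q x y = Q y x) (hQn : Q.Nondegenerate)
    (a b : W →ₗ[ℚ] W) (haa : ∀ x, a (a x) = -x) (hbb : ∀ x, b (b x) = -x) (hab : ∀ x, a (b x) = -b (a x))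
    (haQ : ∀ x y, Q (a x) (a y) = Q x y) (hbQ : ∀ x y, Q (b x) (b y) = Q x y) (φ : W →ₗ[ℚ] W)
    (hφ : ∀ g h : W ≃ₗ[ℚ] W, (∀ x, g (a x) = a (g x)) → (∀ x, g (b x) = b (g x)) → (∀ x y, Q (g x) (g y) = Q x y) →
      (∀ x, h (a x) = a (h x)) → (∀ x, h (b x) = b (h x)) → (∀ x y, Q (h x) (h y) = Q x y) →
      ∀ x, φ ((g * h * g⁻¹ * h⁻¹) x) = (g * h * g⁻¹ * h⁻¹) (φ x)) :
    ∃ α β γ δ : ℚ, φ = α • 1 + β • a + γ • b + δ • (a * b) := by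
  classical
  let bW := Module.finBasis ℚ W
  let A := LinearMap.toMatrix bW bW a
  let B := LinearMap.toMatrix bW bW b
  let G := LinearMap.BilinForm.toMatrix bW Q
  let P := LinearMap.toMatrix bW bW φ
  -- relations in coordinates
  have haa' : a * a = -1 := LinearMap.ext fun x => by simpa using haa x
  have hbb' : b * b = -1 := LinearMap.ext fun x => by simpa using hbb x
  have hab' : a * b = -(b * a) := LinearMap.ext fun x => by simpa using hab x
  have hA : A * A = -1 := by
    change LinearMap.toMatrix bW bW a * LinearMap.toMatrix bW bW a = -1
    rw [← LinearMap.toMatrix_mul, haa', map_neg, LinearMap.toMatrix_one]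
  have hB : B * B = -1 := by
    change LinearMap.toMatrix bW bW b * LinearMap.toMatrix bW bW b = -1
    rw [← LinearMap.toMatrix_mul, hbb', map_neg, LinearMap.toMatrix_one]
  have hAB : A * B = -(B * A) := by
    change LinearMap.toMatrix bW bW a * LinearMap.toMatrix bW bW b = -(LinearMap.toMatrix bW bW b * LinearMap.toMatrix bW bW a)
    rw [← LinearMap.toMatrix_mul, hab', map_neg, LinearMap.toMatrix_mul]
  have hisoG : ∀ (s : W →ₗ[ℚ] W), (∀ x y, Q (s x) (s y) = Q x y) →
      (LinearMap.toMatrix bW bW s)ᵀ * G * LinearMap.toMatrix bW bW s = G := by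
    intro s hs
    have e : Q.comp s s = Q := LinearMap.ext fun x => LinearMap.ext fun y => hs x y
    change (LinearMap.toMatrix bW bW s)ᵀ * LinearMap.BilinForm.toMatrix bW Q * LinearMap.toMatrix bW bW s =
      LinearMap.BilinForm.toMatrix bW Q
    rw [← LinearMap.BilinForm.toMatrix_comp bW bW, e]
  have hAG : Aᵀ * G * A = G := hisoG a haQ
  have hBG : Bᵀ * G * B = G := hisoG b hbQ
  have hGt : Gᵀ = G := by
    ext i j
    change LinearMap.BilinForm.toMatrix bW Q j i = LinearMap.BilinForm.toMatrix bW Q i j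
    rw [LinearMap.BilinForm.toMatrix_apply, LinearMap.BilinForm.toMatrix_apply, hQs]
  have hG : IsUnit G.det := isUnit_iff_ne_zero.mpr ((LinearMap.BilinForm.nondegenerate_iff_det_ne_zero bW).mp hQn)
  have hA4 : A ^ 4 = 1 := by
    rw [show (4 : ℕ) = 2 + 2 from rfl, pow_add, pow_two, hA]; simp
  have hB4 : B ^ 4 = 1 := by
    rw [show (4 : ℕ) = 2 + 2 from rfl, pow_add, pow_two, hB]; simp
  have hBinv : B⁻¹ = -B := Matrix.inv_eq_right_inv (by rw [Matrix.mul_neg, hB, neg_neg])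
  have hAinv : A⁻¹ = -A := Matrix.inv_eq_right_inv (by rw [Matrix.mul_neg, hA, neg_neg])
  have hBA : B⁻¹ * A * B = A⁻¹ := by
    rw [hBinv, hAinv, Matrix.neg_mul, Matrix.neg_mul, Matrix.mul_assoc, show A * B = -(B * A) from hAB, Matrix.mul_neg,
      ← Matrix.mul_assoc, hB, Matrix.neg_mul, Matrix.one_mul, neg_neg]
  -- commutation with the commutators of rational points, in coordinates
  have HP : ∀ g h : Matrix (Fin (Module.finrank ℚ W)) (Fin (Module.finrank ℚ W)) ℚ, IsUnit g.det → IsUnit h.det →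
      g * A = A * g → h * A = A * h → g * B = B * g → h * B = B * h → gᵀ * G * g = G → hᵀ * G * h = G →
      g * h * g⁻¹ * h⁻¹ * P = P * (g * h * g⁻¹ * h⁻¹) := by
    intro g h hg hh hgA hhA hgB hhB hgG hhG
    set eg : W ≃ₗ[ℚ] W := Matrix.toLinearEquiv bW g hg with heg
    set eh : W ≃ₗ[ℚ] W := Matrix.toLinearEquiv bW h hh with heh
    have key : ∀ x, φ ((eg * eh * eg⁻¹ * eh⁻¹) x) = (eg * eh * eg⁻¹ * eh⁻¹) (φ x) :=
      hφ eg eh (comm_toLinearEquiv a g hg hgA) (comm_toLinearEquiv b g hg hgB) (isometry_toLinearEquiv g hg hgG)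
        (comm_toLinearEquiv a h hh hhA) (comm_toLinearEquiv b h hh hhB) (isometry_toLinearEquiv h hh hhG)
    have hKm : LinearMap.toMatrix bW bW ((eg * eh * eg⁻¹ * eh⁻¹ : W ≃ₗ[ℚ] W) : W →ₗ[ℚ] W) = g * h * g⁻¹ * h⁻¹ := by
      -- matrices of products and inverses of automorphisms (the argument of route A's `toMatrix_commutator`)
      have hinv : ∀ ε : W ≃ₗ[ℚ] W, LinearMap.toMatrix bW bW ((ε⁻¹ : W ≃ₗ[ℚ] W) : W →ₗ[ℚ] W) =
          (LinearMap.toMatrix bW bW (ε : W →ₗ[ℚ] W))⁻¹ := by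
        intro ε
        refine (Matrix.inv_eq_left_inv ?_).symm
        rw [← LinearMap.toMatrix_mul]
        have : ((ε⁻¹ : W ≃ₗ[ℚ] W) : W →ₗ[ℚ] W) * (ε : W →ₗ[ℚ] W) = 1 := by
          ext x; simp
        rw [this, LinearMap.toMatrix_one]
      have hmul : ∀ ε ε' : W ≃ₗ[ℚ] W, LinearMap.toMatrix bW bW ((ε * ε' : W ≃ₗ[ℚ] W) : W →ₗ[ℚ] W) =
          LinearMap.toMatrix bW bW (ε : W →ₗ[ℚ] W) * LinearMap.toMatrix bW bW (ε' : W →ₗ[ℚ] W) := by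
        intro ε ε'
        rw [← LinearMap.toMatrix_mul]
        rfl
      rw [hmul, hmul, hmul, hinv, hinv, heg, heh, toMatrix_toLinearEquiv, toMatrix_toLinearEquiv]
    have h1 : LinearMap.toMatrix bW bW (φ ∘ₗ ((eg * eh * eg⁻¹ * eh⁻¹ : W ≃ₗ[ℚ] W) : W →ₗ[ℚ] W)) =
        P * (g * h * g⁻¹ * h⁻¹) := by
      rw [LinearMap.toMatrix_comp bW bW bW, hKm]
    have h2 : LinearMap.toMatrix bW bW (((eg * eh * eg⁻¹ * eh⁻¹ : W ≃ₗ[ℚ] W) : W →ₗ[ℚ] W) ∘ₗ φ) =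
        (g * h * g⁻¹ * h⁻¹) * P := by
      rw [LinearMap.toMatrix_comp bW bW bW, hKm]
    have hcomp : φ ∘ₗ ((eg * eh * eg⁻¹ * eh⁻¹ : W ≃ₗ[ℚ] W) : W →ₗ[ℚ] W) =
        ((eg * eh * eg⁻¹ * eh⁻¹ : W ≃ₗ[ℚ] W) : W →ₗ[ℚ] W) ∘ₗ φ :=
      LinearMap.ext fun x => by simpa only [LinearMap.comp_apply, LinearEquiv.coe_coe] using key x
    rw [← h2, ← hcomp, h1]
  -- the `(2,0)`-tensor `P G⁻¹` is invariant under the commutators of rational points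
  let c : (Fin 2 → Fin (Module.finrank ℚ W)) → ℚ := fun w => (P * G⁻¹) (w 0) (w 1)
  have hc : ∀ g h : Matrix (Fin (Module.finrank ℚ W)) (Fin (Module.finrank ℚ W)) ℚ, IsUnit g.det → IsUnit h.det →
      g * A = A * g → h * A = A * h → g * B = B * g → h * B = B * h → gᵀ * G * g = G → hᵀ * G * h = G →
      tensorPowerMatrix ℚ (Module.finrank ℚ W) 2 (g * h * g⁻¹ * h⁻¹) *ᵥ c = c :=
    fun g h hg hh hgA hhA hgB hhB hgG hhG => (tensorPowerMatrix_two_mulVec_eq_self_iff _ _).2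
      (mul_mul_transpose_eq_of_commute hG (orthogonal_commutator hG hgG hhG) (HP g h hg hh hgA hhA hgB hhB hgG hhG))
  -- ascent to the Cayley `ℂ`-points: `P ⊗ 1` commutes with their commutators
  have hGC := isUnit_det_map G hG
  have hcw : (fun w : Fin 2 → Fin (Module.finrank ℚ W) => algebraMap ℚ ℂ (c w)) =
      fun w => (P.map (algebraMap ℚ ℂ) * (G.map (algebraMap ℚ ℂ))⁻¹) (w 0) (w 1) := by
    funext w
    change algebraMap ℚ ℂ ((P * G⁻¹) (w 0) (w 1)) = _
    rw [← map_nonsing_inv G hG, ← Matrix.map_mul, Matrix.map_apply]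
  have hPC : ∀ g h : Matrix (Fin (Module.finrank ℚ W)) (Fin (Module.finrank ℚ W)) ℂ, IsUnit (1 + g).det →
      IsUnit (1 + h).det →
      g * A.map (algebraMap ℚ ℂ) = A.map (algebraMap ℚ ℂ) * g → h * A.map (algebraMap ℚ ℂ) = A.map (algebraMap ℚ ℂ) * h →
      g * B.map (algebraMap ℚ ℂ) = B.map (algebraMap ℚ ℂ) * g → h * B.map (algebraMap ℚ ℂ) = B.map (algebraMap ℚ ℂ) * h →
      gᵀ * G.map (algebraMap ℚ ℂ) * g = G.map (algebraMap ℚ ℂ) → hᵀ * G.map (algebraMap ℚ ℂ) * h = G.map (algebraMap ℚ ℂ) →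
      g * h * g⁻¹ * h⁻¹ * P.map (algebraMap ℚ ℂ) = P.map (algebraMap ℚ ℂ) * (g * h * g⁻¹ * h⁻¹) := by
    intro g h hg1 hh1 hgA hhA hgB hhB hgG hhG
    have asc := commutator_invariance_ascends₂ A B G (by norm_num : 0 < 4) (by norm_num : 0 < 4) hA4 hB4 hAG hBG hBA
      hGt hG c hc g h hg1 hh1 hgA hhA hgB hhB hgG hhG
    rw [hcw, tensorPowerMatrix_two_mulVec_eq_self_iff] at asc
    exact commute_of_mul_mul_transpose_eq hGC (orthogonal_commutator hGC hgG hhG) asc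
  -- ENGINE-CAYLEY in matrix form over `ℂ`
  have hAC : A.map (algebraMap ℚ ℂ) * A.map (algebraMap ℚ ℂ) = -1 := by
    rw [← Matrix.map_mul, hA, Matrix.map_neg _ (map_neg (algebraMap ℚ ℂ)), Matrix.map_one _ (map_zero _) (map_one _)]
  have hBC : B.map (algebraMap ℚ ℂ) * B.map (algebraMap ℚ ℂ) = -1 := by
    rw [← Matrix.map_mul, hB, Matrix.map_neg _ (map_neg (algebraMap ℚ ℂ)), Matrix.map_one _ (map_zero _) (map_one _)]
  have hABC : A.map (algebraMap ℚ ℂ) * B.map (algebraMap ℚ ℂ) = -(B.map (algebraMap ℚ ℂ) * A.map (algebraMap ℚ ℂ)) := by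
    rw [← Matrix.map_mul, hAB, Matrix.map_neg _ (map_neg (algebraMap ℚ ℂ)), Matrix.map_mul]
  have hAGC : (A.map (algebraMap ℚ ℂ))ᵀ * G.map (algebraMap ℚ ℂ) * A.map (algebraMap ℚ ℂ) = G.map (algebraMap ℚ ℂ) := by
    rw [← Matrix.transpose_map, ← Matrix.map_mul, ← Matrix.map_mul, hAG]
  have hBGC : (B.map (algebraMap ℚ ℂ))ᵀ * G.map (algebraMap ℚ ℂ) * B.map (algebraMap ℚ ℂ) = G.map (algebraMap ℚ ℂ) := by
    rw [← Matrix.transpose_map, ← Matrix.map_mul, ← Matrix.map_mul, hBG]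
  have hGtC : (G.map (algebraMap ℚ ℂ))ᵀ = G.map (algebraMap ℚ ℂ) := by rw [← Matrix.transpose_map, hGt]
  obtain ⟨α, β, γ, δ, hPC'⟩ := exists_eq_quaternion_of_commute_cayley_commutators _ _ _ _ hAC hBC hABC hAGC hBGC hGtC
    hGC hPC
  -- descent and back to endomorphisms
  obtain ⟨α', β', γ', δ', hP⟩ := exists_rat_coeffs_of_map_eq P A B hPC'
  refine ⟨α', β', γ', δ', (LinearMap.toMatrix bW bW).injective ?_⟩
  change P = LinearMap.toMatrix bW bW (α' • 1 + β' • a + γ' • b + δ' • (a * b))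
  rw [hP, map_add, map_add, map_add, map_smul, map_smul, map_smul, map_smul, LinearMap.toMatrix_one,
    LinearMap.toMatrix_mul]

end Summit.HodgeConjecture.HodgeConjecture.Theorems.Q8SymplecticPowersEndomorphismAlgebra

end
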